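import Summits.ValiantsHypothesis.ValiantsHypothesis.Theses.Depth4
import HarnessLib
import HarnessLib.Audit

/-!
# Depth4 — the chasm axis for `per` over `ℂ`: the inhomogeneous depth-5 chasm sits at the cube-root
# scale (Kumar–Saptharishi 2017, Lemma 29), so `Depth4GeneralExp` is summit-sufficient; the
# VP-saturation lock one scale down; the homogeneous depth-5 door

Workshop decomp-valiant, lens 4 (depth-reduction / chasm axis), gen 20; CALLED build O14/O14′ (critic
2026-08-30T20:49:57Z / 21:02:51Z), `--supports stmt-ValiantsHypothesis-0331`.  Support theorems and typed
hypotheses only: no item closed, no statement of route Depth4 changes, `VP ≠ VNP` untouched.  Measures: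
`productDepthCircuitSize 2` = INHOMOGENEOUS product-depth `≤ 2`, gates counted, constants free
(the measure of the route's target `Depth4Thesis` and support `Depth4GeneralExp`);
`homProductDepthCircuitSize 2` = HOMOGENEOUS product-depth `≤ 2` (`ΣΠΣΠΣ`; the measure of
`Depth4Homogeneous` and of the open class `Literature.Barriers.ValiantsHypothesis.ImprovedDepthReduction`).

§1  Over characteristic `0` the printed chasm on the INHOMOGENEOUS measure is `n^{Θ(d^{1/3})}`, not
    `n^{Θ(√d)}` [Kumar–Saptharishi, CCC 2017, §7.5: Lemma 28 (homogeneous depth 6, all product fan-ins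
    `O(d^{1/3})`, size `exp(O(d^{1/3} log d))`) and Lemma 29 (GKKS duality on the inner parts:
    NON-homogeneous depth 5, same size), with the remark (p. 5) "it suffices to prove an
    `exp(ω(d^{1/3} log d))` lower bound for an explicit polynomial computed by such circuits to separate
    VNP from VP"].  Typed as the HYPOTHESIS `DepthFiveChasm` (not formalised, not asserted, not a
    Literature fact).  Kernel: (α) `vh_of_depthFiveChasm : DepthFiveChasm → Depth5InhomThesis → VH` and
    `depth5InhomThesis_of_depth4Thesis` (the route's target is stronger than the residual on its own
    measure); (β) `depth5InhomThesis_of_depth4GeneralExp` (pure arithmetic, `cubeRoot_window`), hence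
    `vh_of_depthFiveChasm_of_depth4GeneralExp : DepthFiveChasm → Depth4GeneralExp → VH` — item 0331 is
    summit-sufficient modulo a printed theorem, not an intermediate rung; (γ) the VP-saturation lock one
    scale down: `chasm3_bound_of_vpSaturated`, `not_depth5Inhom_witness_of_vpSaturated`.
§2  HOMOGENEOUS measure: the door `vh_of_improvedDepthReduction` (improved reduction ∧ fixed-`ε` bound
    `PerHomDepthFiveHard` → VH) and its lock `not_improvedDepthReduction_of_dominated_witness`.
FARM NOTE (maintenance pass = mechanical re-folding): at build time the module
`Literature/Barriers/ValiantsHypothesis/DepthReductionChasm.lean` had no olean on the farm, so it is NOT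
imported and none of its declarations is restated; these of its declarations appear with their BODIES
UNFOLDED verbatim (namespace `Literature.Barriers.ValiantsHypothesis`): `PolyMeasure` (as the binder type
`∀ ⦃σ : Type⦄, MvPolynomial σ ℂ → ℕ∞`), `PolyMeasure.IsDepthFourSound` + `PolyMeasure.VPSaturated` (hyps
`hμ`, `hg`/`hdeg`/`hle` of `chasm3_bound_of_vpSaturated`, `not_depth5Inhom_witness_of_vpSaturated`),
`PolyMeasure.IsHomDepthFourSound` (hyp `hμ` of `not_improvedDepthReduction_of_dominated_witness`),
`ImprovedDepthReduction` (hyp `hR` of `vh_of_improvedDepthReduction`; negated conclusion of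
`not_improvedDepthReduction_of_dominated_witness`); and the proofs of its `two_le_rpow_half`,
`ceil_lt_ceil_mul_self` are inlined as `have` steps in `not_ceil_rpow_le_half`.
Honest grade (critic's sentence of record): (α)/(β) known-in-print-as-remark (KS17 L28–29, p. 5),
kernel-new as typed implications; (γ)/(δ) bookkeeping generalisations of tree theorems + a typed door;
value = record CORRECTION on named cells (0331 not sub-S; C1 window wording) — no S-tag moves toward a
proof, 0331's move is AWAY from «weaker»; rung 0; VP≠VNP untouched.  References: KumarSaptharishi2017
(§7.4–7.5, Lemmas 28–29); KumarSaraf2017 (Cor. 1.3); Tavenas2015; GuptaKamathKayalSaptharishi2016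
(Thm. 1.1); AmireddyGargKayalSahaThankey2023 (Open Problem 1.2). -/

noncomputable section

open MvPolynomial

set_option linter.dupNamespace false

namespace Summit.ValiantsHypothesis.ValiantsHypothesis.Theorems.Depth4ChasmAxis

open Literature.Computability.AlgebraicComplexity
open Summit.ValiantsHypothesis.ValiantsHypothesis.Theses.Depth4


/-! ### §0 Shared bookkeeping: `per` is a `VP` family if `VP = VNP` (`deg per_n = n` is the tree's
`totalDegree_perPoly_holds`) -/

/-- Under `VP ℂ = VNP ℂ` the permanent family is a `VP` family (renaming bridge
`mem_VP_ofFintype_iff_holds` + `perFamily_mem_VNP_holds`, as in route Depth4's `closes`).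
[cite: Valiant1979] [cite: Burgisser2000, Thm. 2.10] -/
theorem isVPFamily_per_of_eq (hEq : VP ℂ = VNP ℂ) :
    IsVPFamily (fun n => perPoly (Fin n) ℂ) := by
  have hVNP := perFamily_mem_VNP_holds ℂ
  have hVP : perFamily ℂ ∈ VP ℂ := by rw [hEq]; exact hVNP
  exact (mem_VP_ofFintype_iff_holds _).1 hVP

/-! ### §1 The inhomogeneous product-depth-2 chasm over `ℂ` sits at the cube-root scale -/

/-- **Typed print theorem (HYPOTHESIS only — a typed stub: not asserted, not a Literature fact, not an
item, no cite tag so that it is NOT filed as a named fact): the non-homogeneous depth-5 chasm over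
characteristic zero** — every `VP` family `f` over `ℂ` has, for some `c` and all `n`, `k` with
`deg fₙ ≤ k³`, inhomogeneous product-depth-`2` circuits of size `≤ (n+2)^{c·k+c}` (Tavenas run to
homogeneous depth 6 with product fan-ins `O(d^{1/3})`, then Gupta–Kamath–Kayal–Saptharishi duality on the
inner parts; print: `poly(d)` variables and size, `exp(O(d^{1/3} log d))`, Kumar–Saptharishi, CCC 2017,
§7.5, Lemmas 28–29 and p. 5; `VP`-family form as the tree renders Tavenas in `Depth4Tavenas`).
[status: theorem in print — Kumar–Saptharishi CCC 2017 Lemma 29, char 0; NOT formalised; hypothesis-only] -/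
def DepthFiveChasm : Prop :=
  ∀ {σ : ℕ → Type} [∀ n, Fintype (σ n)] (f : ∀ n, MvPolynomial (σ n) ℂ), IsVPFamily f →
    ∃ c : ℕ, ∀ n k : ℕ, (f n).totalDegree ≤ k ^ 3 →
      productDepthCircuitSize 2 (f n) ≤ ((n + 2 : ℕ∞) ^ (c * k + c))

/-- **The residual on the inhomogeneous product-depth-2 measure** (typed target, cube-root scale,
root-free; asserted nowhere, not a fact, not an item): for every `c` some `n` and `k` with `n ≤ k³` have
`(n+2)^{c·k+c} < productDepthCircuitSize 2 (per_n)` — `per_n` needs inhomogeneous `ΣΠΣΠΣ` size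
`n^{ω(n^{1/3})}` infinitely often.  Sufficient for `VH` given `DepthFiveChasm` (`vh_of_depthFiveChasm`);
implied by the route's target `Depth4Thesis` and by its support `Depth4GeneralExp` (below). -/
def Depth5InhomThesis : Prop :=
  ∀ c : ℕ, ∃ n k : ℕ, n ≤ k ^ 3 ∧
    ((n + 2 : ℕ∞) ^ (c * k + c)) < productDepthCircuitSize 2 (perPoly (Fin n) ℂ)

/-- **(closes, inhomogeneous cell)** `DepthFiveChasm → Depth5InhomThesis → VH`: if `VP = VNP`
then `per` is a `VP` family of degree `n`, so the chasm bounds `productDepthCircuitSize 2 (per_n)`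
by `(n+2)^{c·k+c}` for all `n ≤ k³`, contradicting the thesis at that `c`.
[cite: KumarSaptharishi2017, p. 31:5] -/
theorem vh_of_depthFiveChasm (hR : DepthFiveChasm) (hL : Depth5InhomThesis) :
    _root_.ValiantsHypothesis := by
  show VP ℂ ≠ VNP ℂ
  intro hEq
  have hfam := isVPFamily_per_of_eq hEq
  obtain ⟨c, hc⟩ := hR (fun n => perPoly (Fin n) ℂ) hfam
  obtain ⟨n, k, hnk, hlt⟩ := hL c
  have hdeg : (perPoly (Fin n) ℂ).totalDegree ≤ k ^ 3 := by
    rw [totalDegree_perPoly_holds (n := Fin n) (k := ℂ), Fintype.card_fin]; exact hnk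
  exact absurd (lt_of_lt_of_le hlt (hc n k hdeg)) (lt_irrefl _)

/-- **(α) the route's target is stronger than the residual on its own measure**:
`Depth4Thesis → Depth5InhomThesis` (take `k = ⌊√n⌋ + 2`, so `n < (⌊√n⌋+1)² ≤ k³`, and
`c·k + c = c⌊√n⌋ + 3c ≤ 3c⌊√n⌋ + 3c`). [folklore] -/
theorem depth5InhomThesis_of_depth4Thesis (h : Depth4Thesis) : Depth5InhomThesis := by
  intro c
  obtain ⟨n, hn⟩ := h (3 * c)
  refine ⟨n, Nat.sqrt n + 2, ?_, lt_of_le_of_lt ?_ hn⟩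
  · have h1 : n < (Nat.sqrt n + 1) ^ 2 := Nat.lt_succ_sqrt' n
    have h2 : (Nat.sqrt n + 1) ^ 2 ≤ (Nat.sqrt n + 2) ^ 3 :=
      calc (Nat.sqrt n + 1) ^ 2 ≤ (Nat.sqrt n + 2) ^ 2 := Nat.pow_le_pow_left (by omega) 2
        _ ≤ (Nat.sqrt n + 2) ^ 3 := Nat.pow_le_pow_right (by omega) (by norm_num)
    omega
  · refine pow_le_pow_right₀ (le_add_left (by norm_num)) ?_
    nlinarith [Nat.zero_le (c * Nat.sqrt n)]

/-- `16·(y+1) ≤ 2^y` for `y ≥ 8`. [folklore] -/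
theorem sixteen_mul_succ_le_two_pow {y : ℕ} (hy : 8 ≤ y) : 16 * (y + 1) ≤ 2 ^ y := by
  induction y, hy using Nat.le_induction with
  | base => norm_num
  | succ m hm ih =>
    have h16 : 16 ≤ 2 ^ m :=
      le_trans (by norm_num : 16 ≤ 2 ^ 8) (Nat.pow_le_pow_right (by norm_num) hm)
    calc 16 * (m + 1 + 1) = 16 * (m + 1) + 16 := by ring
      _ ≤ 2 ^ m + 2 ^ m := add_le_add ih h16
      _ = 2 ^ (m + 1) := by ring

/-- `x^16 < 2^x` for `x ≥ 128`. [folklore] -/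
theorem pow_sixteen_lt_two_pow {x : ℕ} (hx : 128 ≤ x) : x ^ 16 < 2 ^ x := by
  have hy : 8 ≤ x / 16 := (Nat.le_div_iff_mul_le (by norm_num)).2 (by omega)
  have h1 : x < 16 * (x / 16 + 1) := Nat.lt_mul_div_succ x (by norm_num)
  have h2 : x < 2 ^ (x / 16) := lt_of_lt_of_le h1 (sixteen_mul_succ_le_two_pow hy)
  calc x ^ 16 < (2 ^ (x / 16)) ^ 16 := Nat.pow_lt_pow_left h2 (by norm_num)
    _ = 2 ^ (16 * (x / 16)) := by rw [← pow_mul, mul_comm]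
    _ ≤ 2 ^ x := Nat.pow_le_pow_right (by norm_num) (Nat.mul_div_le x 16)

/-- **The cube-root window**: for all `c`, `c' > 0`, every large `n` admits `k` with `n ≤ k³`
and `(n+2)^{c·k+c} < 2^{⌊√n⌋/c'}` (take `p ≈ n^{1/16}` by four integer square roots,
`k = (p+1)⁶ ≈ n^{3/8}`, and use `n + 2 ≤ 2^{p+1}`, `p⁸ ≤ ⌊√n⌋`). [folklore] -/
theorem cubeRoot_window (c c' : ℕ) (hc' : 0 < c') :
    ∃ n₀ : ℕ, ∀ n : ℕ, n₀ ≤ n →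
      ∃ k : ℕ, n ≤ k ^ 3 ∧ (n + 2) ^ (c * k + c) < 2 ^ (Nat.sqrt n / c') := by
  set P : ℕ := 128 + (256 * c + 1) * c' with hP
  refine ⟨P ^ 16, fun n hn => ?_⟩
  set s : ℕ := Nat.sqrt n with hs
  set q : ℕ := Nat.sqrt s with hq
  set o : ℕ := Nat.sqrt q with ho
  set p : ℕ := Nat.sqrt o with hp
  have hsP : P ^ 8 ≤ s := by
    have h := Nat.sqrt_le_sqrt hn
    rwa [show P ^ 16 = (P ^ 8) ^ 2 by ring, Nat.sqrt_eq'] at h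
  have hqP : P ^ 4 ≤ q := by
    have h := Nat.sqrt_le_sqrt hsP
    rwa [show P ^ 8 = (P ^ 4) ^ 2 by ring, Nat.sqrt_eq'] at h
  have hoP : P ^ 2 ≤ o := by
    have h := Nat.sqrt_le_sqrt hqP
    rwa [show P ^ 4 = (P ^ 2) ^ 2 by ring, Nat.sqrt_eq'] at h
  have hpP : P ≤ p := by
    have h := Nat.sqrt_le_sqrt hoP
    rwa [Nat.sqrt_eq'] at h
  have hs' : n < (s + 1) ^ 2 := Nat.lt_succ_sqrt' n
  have hq' : s < (q + 1) ^ 2 := Nat.lt_succ_sqrt' s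
  have ho' : q < (o + 1) ^ 2 := Nat.lt_succ_sqrt' q
  have hp' : o < (p + 1) ^ 2 := Nat.lt_succ_sqrt' o
  have hn16 : n < (p + 1) ^ 16 :=
    calc n < (s + 1) ^ 2 := hs'
      _ ≤ ((q + 1) ^ 2) ^ 2 := Nat.pow_le_pow_left hq' 2
      _ ≤ (((o + 1) ^ 2) ^ 2) ^ 2 := Nat.pow_le_pow_left (Nat.pow_le_pow_left ho' 2) 2
      _ ≤ ((((p + 1) ^ 2) ^ 2) ^ 2) ^ 2 :=
          Nat.pow_le_pow_left (Nat.pow_le_pow_left (Nat.pow_le_pow_left hp' 2) 2) 2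
      _ = (p + 1) ^ 16 := by ring
  have hp8 : p ^ 8 ≤ s := by
    have e1 : p ^ 2 ≤ o := Nat.sqrt_le' o
    have e2 : o ^ 2 ≤ q := Nat.sqrt_le' q
    have e3 : q ^ 2 ≤ s := Nat.sqrt_le' s
    calc p ^ 8 = ((p ^ 2) ^ 2) ^ 2 := by ring
      _ ≤ (o ^ 2) ^ 2 := Nat.pow_le_pow_left (Nat.pow_le_pow_left e1 2) 2
      _ ≤ q ^ 2 := Nat.pow_le_pow_left e2 2
      _ ≤ s := e3
  have hp128 : 128 ≤ p + 1 := by omega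
  have h2pow : (p + 1) ^ 16 < 2 ^ (p + 1) := pow_sixteen_lt_two_pow hp128
  have hn2 : n + 2 ≤ 2 ^ (p + 1) := by omega
  refine ⟨(p + 1) ^ 6, ?_, ?_⟩
  · have h18 : (p + 1) ^ 16 ≤ ((p + 1) ^ 6) ^ 3 := by
      rw [← pow_mul]
      exact Nat.pow_le_pow_right (by omega) (by norm_num)
    omega
  · have hk : c * (p + 1) ^ 6 + c ≤ 2 * c * (p + 1) ^ 6 := by
      have : 1 ≤ (p + 1) ^ 6 := Nat.one_le_pow _ _ (by omega)
      nlinarith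
    have hexp : (p + 1) * (c * (p + 1) ^ 6 + c) ≤ 2 * c * (p + 1) ^ 7 :=
      calc (p + 1) * (c * (p + 1) ^ 6 + c) ≤ (p + 1) * (2 * c * (p + 1) ^ 6) :=
            Nat.mul_le_mul_left _ hk
        _ = 2 * c * (p + 1) ^ 7 := by ring
    have hkey : 2 * c * (p + 1) ^ 7 < s / c' := by
      have hp1 : p + 1 ≤ 2 * p := by omega
      have h7 : (p + 1) ^ 7 ≤ 2 ^ 7 * p ^ 7 :=
        calc (p + 1) ^ 7 ≤ (2 * p) ^ 7 := Nat.pow_le_pow_left hp1 7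
          _ = 2 ^ 7 * p ^ 7 := by ring
      have hPp : (256 * c + 1) * c' ≤ p := by omega
      have hp7 : 1 ≤ p ^ 7 := Nat.one_le_pow _ _ (by omega)
      have hA : (2 * c * (p + 1) ^ 7 + 1) * c' ≤ (256 * c + 1) * c' * p ^ 7 :=
        calc (2 * c * (p + 1) ^ 7 + 1) * c' ≤ (2 * c * (2 ^ 7 * p ^ 7) + p ^ 7) * c' :=
              Nat.mul_le_mul_right _ (add_le_add (Nat.mul_le_mul_left _ h7) hp7)
          _ = (256 * c + 1) * c' * p ^ 7 := by ring
      have hB : (256 * c + 1) * c' * p ^ 7 ≤ p ^ 8 :=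
        calc (256 * c + 1) * c' * p ^ 7 ≤ p * p ^ 7 := Nat.mul_le_mul_right _ hPp
          _ = p ^ 8 := by ring
      have hle : 2 * c * (p + 1) ^ 7 + 1 ≤ s / c' :=
        (Nat.le_div_iff_mul_le hc').2 (hA.trans (hB.trans hp8))
      omega
    calc (n + 2) ^ (c * (p + 1) ^ 6 + c) ≤ (2 ^ (p + 1)) ^ (c * (p + 1) ^ 6 + c) :=
          Nat.pow_le_pow_left hn2 _
      _ = 2 ^ ((p + 1) * (c * (p + 1) ^ 6 + c)) := by rw [← pow_mul]
      _ ≤ 2 ^ (2 * c * (p + 1) ^ 7) := Nat.pow_le_pow_right (by norm_num) hexp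
      _ < 2 ^ (s / c') := Nat.pow_lt_pow_right (by norm_num) hkey

/-- **(β) `Depth4GeneralExp → Depth5InhomThesis`**: an exponential bound `2^{⌊√n⌋/c'}` on
`productDepthCircuitSize 2 (per_n)` (eventually) crosses the cube-root chasm `(n+2)^{c·k+c}`,
`n ≤ k³`, for every `c`. [folklore] [cite: KumarSaptharishi2017, p. 31:5] -/
theorem depth5InhomThesis_of_depth4GeneralExp (h : Depth4GeneralExp) : Depth5InhomThesis := by
  obtain ⟨c', hc', n₁, hlow⟩ := h
  intro c
  obtain ⟨n₀, hn₀⟩ := cubeRoot_window c c' hc'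
  obtain ⟨k, hnk, hlt⟩ := hn₀ (max n₀ n₁) (le_max_left _ _)
  refine ⟨max n₀ n₁, k, hnk, lt_of_lt_of_le ?_ (hlow _ (le_max_right _ _))⟩
  have hcast : (((max n₀ n₁ + 2) ^ (c * k + c) : ℕ) : ℕ∞) <
      ((2 ^ (Nat.sqrt (max n₀ n₁) / c') : ℕ) : ℕ∞) := by exact_mod_cast hlt
  simpa using hcast

/-- **(β, assembled) `Depth4GeneralExp` is summit-sufficient given the printed chasm**:
`DepthFiveChasm → Depth4GeneralExp → VH`.  Item 0331 of route Depth4 is not an intermediate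
rung on this measure. [cite: KumarSaptharishi2017, p. 31:5 and Lemma 29] -/
theorem vh_of_depthFiveChasm_of_depth4GeneralExp (hR : DepthFiveChasm) (h : Depth4GeneralExp) :
    _root_.ValiantsHypothesis :=
  vh_of_depthFiveChasm hR (depth5InhomThesis_of_depth4GeneralExp h)

/-- **The cube-root chasm constrains `VP`-saturated measures** (given `DepthFiveChasm`): `μ` sound for
`productDepthCircuitSize 2` (`hμ` = `PolyMeasure.IsDepthFourSound μ` unfolded) and `VP`-saturated at `per`
with slack `C` from `n₁` on (`hg`, `hdeg`, `hle` = `PolyMeasure.VPSaturated μ C n₁` unfolded) obeys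
`μ(per_n) ≤ (n+2)^{c·k+c}` whenever `n₁ ≤ n ≤ k³`; depth-4 version: `PolyMeasure.chasm_bound_of_vpSaturated`.
[cite: KumarSaptharishi2017, Lemma 29] [cite: KumarSaraf2017, Cor. 1.3 and §10] -/
theorem chasm3_bound_of_vpSaturated (hR : DepthFiveChasm)
    {μ : ∀ ⦃σ : Type⦄, MvPolynomial σ ℂ → ℕ∞}
    (hμ : ∀ ⦃σ : Type⦄ [Fintype σ] (f : MvPolynomial σ ℂ), μ f ≤ productDepthCircuitSize 2 f)
    {C n₁ : ℕ} {σ : ℕ → Type} [∀ n, Fintype (σ n)] {g : ∀ n, MvPolynomial (σ n) ℂ}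
    (hg : IsVPFamily g) (hdeg : ∀ n, (g n).totalDegree ≤ n)
    (hle : ∀ n : ℕ, n₁ ≤ n → μ (perPoly (Fin n) ℂ) ≤ μ (g n) ^ C) :
    ∃ c : ℕ, ∀ n k : ℕ, n₁ ≤ n → n ≤ k ^ 3 →
      μ (perPoly (Fin n) ℂ) ≤ ((n + 2 : ℕ∞) ^ (c * k + c)) := by
  obtain ⟨c, hc⟩ := hR g hg
  refine ⟨C * c, fun n k hn hk => (hle n hn).trans ?_⟩
  have h1 : μ (g n) ≤ ((n + 2 : ℕ∞) ^ (c * k + c)) :=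
    (hμ (g n)).trans (hc n k ((hdeg n).trans hk))
  calc μ (g n) ^ C ≤ (((n + 2 : ℕ∞) ^ (c * k + c))) ^ C := pow_le_pow_left' h1 C
    _ = ((n + 2 : ℕ∞) ^ (C * c * k + C * c)) := by rw [← pow_mul]; congr 1; ring

/-- **Hence no witness for `Depth5InhomThesis` from a `VP`-saturated measure** (the thesis with `μ`
in place of `productDepthCircuitSize 2`; saturation from `n₁ = 0`), given `DepthFiveChasm` — the
depth-4 statement is the tree's `PolyMeasure.not_depth4_witness_of_vpSaturated`.
[cite: KumarSaptharishi2017, Lemma 29] [cite: KumarSaraf2017, Cor. 1.3 and §10] -/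
theorem not_depth5Inhom_witness_of_vpSaturated (hR : DepthFiveChasm)
    {μ : ∀ ⦃σ : Type⦄, MvPolynomial σ ℂ → ℕ∞}
    (hμ : ∀ ⦃σ : Type⦄ [Fintype σ] (f : MvPolynomial σ ℂ), μ f ≤ productDepthCircuitSize 2 f)
    {C : ℕ} {σ : ℕ → Type} [∀ n, Fintype (σ n)] {g : ∀ n, MvPolynomial (σ n) ℂ}
    (hg : IsVPFamily g) (hdeg : ∀ n, (g n).totalDegree ≤ n)
    (hle : ∀ n : ℕ, 0 ≤ n → μ (perPoly (Fin n) ℂ) ≤ μ (g n) ^ C) :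
    ¬ ∀ c : ℕ, ∃ n k : ℕ, n ≤ k ^ 3 ∧ ((n + 2 : ℕ∞) ^ (c * k + c)) < μ (perPoly (Fin n) ℂ) := by
  obtain ⟨c, hc⟩ := chasm3_bound_of_vpSaturated hR hμ hg hdeg hle
  intro h
  obtain ⟨n, k, hk, hlt⟩ := h c
  exact (not_lt.mpr (hc n k (Nat.zero_le _) hk)) hlt

/-! ### §2 The homogeneous product-depth-2 (depth-5) DOOR over `ℂ` -/

/-- **The lower-bound leaf of the door** (typed target, fixed `ε`, eventually; asserted nowhere, not a
fact, not an item): some `ε > 0` and `n₀` with `⌈n^{ε√n}⌉ ≤ homProductDepthCircuitSize 2 (per_n)` for all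
`n ≥ n₀`.  NOT the `∀ c` residual (it does not by itself give `VH`), hence not caught by the
`VP`-saturation cap; not known for any explicit family over `ℂ` at high degree (Amireddy–Garg–Kayal–Saha–
Thankey 2023, Open Problem 1.2; over `𝔽_q`: `exp(Ω_q(√d))` for a Nisan–Wigderson `VNP` family,
Kumar–Saptharishi 2017, Thm. 1). -/
def PerHomDepthFiveHard : Prop :=
  ∃ (n₀ : ℕ) (ε : ℝ), 0 < ε ∧ ∀ n : ℕ, n₀ ≤ n →
    ((⌈(n : ℝ) ^ (ε * Real.sqrt n)⌉₊ : ℕ) : ℕ∞) ≤ homProductDepthCircuitSize 2 (perPoly (Fin n) ℂ)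

/-- Arithmetic core (the computation inside the tree's `not_improvedDepthReduction`, inlined): from
some `m` on, `⌈n^{ε√n}⌉ ≤ ⌈n^{(ε/2)√n}⌉` is impossible (`n^{(ε/2)√n} ≥ 2` once `n ≥ (2/ε)²`, and
`⌈x⌉ < ⌈x·x⌉` for `x ≥ 2`). [folklore] -/
theorem not_ceil_rpow_le_half {ε : ℝ} (hε : 0 < ε) :
    ∃ m : ℕ, ∀ n : ℕ, m ≤ n →
      ¬ (⌈(n : ℝ) ^ (ε * Real.sqrt n)⌉₊ ≤ ⌈(n : ℝ) ^ (ε / 2 * Real.sqrt n)⌉₊) := by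
  refine ⟨max 4 ⌈(2 / ε) ^ 2⌉₊, fun n hn hle => ?_⟩
  have h4 : 4 ≤ n := le_trans (le_max_left _ _) hn
  have hceil : ⌈(2 / ε) ^ 2⌉₊ ≤ n := le_trans (le_max_right _ _) hn
  have hreal : (2 / ε) ^ 2 ≤ (n : ℝ) := Nat.ceil_le.1 hceil
  -- `2 ≤ n^{(ε/2)√n}` and `n^{ε√n} = n^{(ε/2)√n} · n^{(ε/2)√n}`
  have hn4 : (4 : ℝ) ≤ n := by exact_mod_cast h4
  have hn1 : (1 : ℝ) ≤ n := by linarith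
  have hnpos : (0 : ℝ) < n := by linarith
  have hsqrt : 2 / ε ≤ Real.sqrt n := by
    have := Real.sqrt_le_sqrt hreal
    rwa [Real.sqrt_sq (by positivity)] at this
  have hexp : (1 : ℝ) ≤ ε / 2 * Real.sqrt n := by
    have hε2 : (0 : ℝ) ≤ ε / 2 := by positivity
    calc (1 : ℝ) = ε / 2 * (2 / ε) := by field_simp
      _ ≤ ε / 2 * Real.sqrt n := mul_le_mul_of_nonneg_left hsqrt hε2
  have htwo : 2 ≤ (n : ℝ) ^ (ε / 2 * Real.sqrt n) :=
    calc (2 : ℝ) ≤ n := by linarith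
      _ = (n : ℝ) ^ (1 : ℝ) := (Real.rpow_one _).symm
      _ ≤ (n : ℝ) ^ (ε / 2 * Real.sqrt n) := Real.rpow_le_rpow_of_exponent_le hn1 hexp
  have hsq : (n : ℝ) ^ (ε * Real.sqrt n) =
      (n : ℝ) ^ (ε / 2 * Real.sqrt n) * (n : ℝ) ^ (ε / 2 * Real.sqrt n) := by
    rw [← Real.rpow_add hnpos]; congr 1; ring
  rw [hsq] at hle
  -- `⌈x⌉ < ⌈x·x⌉` for `x ≥ 2`
  have hlt : ⌈(n : ℝ) ^ (ε / 2 * Real.sqrt n)⌉₊ <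
      ⌈(n : ℝ) ^ (ε / 2 * Real.sqrt n) * (n : ℝ) ^ (ε / 2 * Real.sqrt n)⌉₊ := by
    refine Nat.lt_ceil.2 ?_
    have h1 : (⌈(n : ℝ) ^ (ε / 2 * Real.sqrt n)⌉₊ : ℝ) < (n : ℝ) ^ (ε / 2 * Real.sqrt n) + 1 :=
      Nat.ceil_lt_add_one (by linarith)
    have h2 : (n : ℝ) ^ (ε / 2 * Real.sqrt n) + 1 ≤
        (n : ℝ) ^ (ε / 2 * Real.sqrt n) * (n : ℝ) ^ (ε / 2 * Real.sqrt n) := by nlinarith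
    exact h1.trans_le h2
  omega

/-- **(closes, homogeneous cell) THE DOOR**: `ImprovedDepthReduction ∧ PerHomDepthFiveHard → VH` (`hR` =
the body of `Literature.Barriers.ValiantsHypothesis.ImprovedDepthReduction`, verbatim; pass a term of that
type directly).  If `VP = VNP`, `per` is a homogeneous degree-`n` `VP` family and the reduction at `ε/2`
bounds `homProductDepthCircuitSize 2 (per_n)` by `⌈n^{(ε/2)√n}⌉`, against the leaf's `⌈n^{ε√n}⌉`.
[cite: KumarSaraf2017, §1 (p. 3)] [cite: AmireddyGargKayalSahaThankey2023, Open Problem 1.2] -/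
theorem vh_of_improvedDepthReduction
    (hR : ∀ {σ : ℕ → Type} [∀ n, Fintype (σ n)] (f : ∀ n, MvPolynomial (σ n) ℂ),
      IsVPFamily f → (∀ n, (f n).IsHomogeneous n) →
        ∀ ε : ℝ, 0 < ε → ∃ n₀ : ℕ, ∀ n : ℕ, n₀ ≤ n →
          homProductDepthCircuitSize 2 (f n) ≤ ((⌈(n : ℝ) ^ (ε * Real.sqrt n)⌉₊ : ℕ) : ℕ∞))
    (hL : PerHomDepthFiveHard) : _root_.ValiantsHypothesis := by
  show VP ℂ ≠ VNP ℂ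
  intro hEq
  have hfam := isVPFamily_per_of_eq hEq
  have hhom : ∀ n : ℕ, (perPoly (Fin n) ℂ).IsHomogeneous n := fun n => by
    simpa only [Fintype.card_fin] using (perPoly_isHomogeneous (n := Fin n) (k := ℂ))
  obtain ⟨n₀, ε, hε, hlow⟩ := hL
  obtain ⟨n₁, hup⟩ := hR (fun n => perPoly (Fin n) ℂ) hfam hhom (ε / 2) (half_pos hε)
  obtain ⟨m, hm⟩ := not_ceil_rpow_le_half hε
  set n : ℕ := max (max n₀ n₁) m with hn
  have hn₀ : n₀ ≤ n := le_max_of_le_left (le_max_left _ _)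
  have hn₁ : n₁ ≤ n := le_max_of_le_left (le_max_right _ _)
  have hnm : m ≤ n := le_max_right _ _
  have h12 : ((⌈(n : ℝ) ^ (ε * Real.sqrt n)⌉₊ : ℕ) : ℕ∞) ≤
      ((⌈(n : ℝ) ^ (ε / 2 * Real.sqrt n)⌉₊ : ℕ) : ℕ∞) := (hlow n hn₀).trans (hup n hn₁)
  exact hm n hnm (by exact_mod_cast h12)

/-- **The door's own lock**: if the leaf `PerHomDepthFiveHard` is delivered by a measure `μ` sound for
homogeneous product-depth-`2` size (`hμ` = `PolyMeasure.IsHomDepthFourSound μ` unfolded) and DOMINATED on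
the permanent by a homogeneous degree-`n` `VP` family `g` from `n₁` on (the situation of every
(projected-)shifted-partials measure, maximised by `IMM ∈ VP`), then `ImprovedDepthReduction` (unfolded)
is FALSE. [cite: KumarSaraf2017, Cor. 1.3 and §10] [cite: KumarSaptharishi2017, §7.2–7.4] -/
theorem not_improvedDepthReduction_of_dominated_witness
    {μ : ∀ ⦃σ : Type⦄, MvPolynomial σ ℂ → ℕ∞}
    (hμ : ∀ ⦃σ : Type⦄ [Fintype σ] (f : MvPolynomial σ ℂ), μ f ≤ homProductDepthCircuitSize 2 f)
    {σ : ℕ → Type} [∀ n, Fintype (σ n)] {g : ∀ n, MvPolynomial (σ n) ℂ}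
    (hg : IsVPFamily g) (hghom : ∀ n, (g n).IsHomogeneous n) {n₁ : ℕ}
    (hdom : ∀ n : ℕ, n₁ ≤ n → μ (perPoly (Fin n) ℂ) ≤ μ (g n))
    (hwit : ∃ (n₀ : ℕ) (ε : ℝ), 0 < ε ∧ ∀ n : ℕ, n₀ ≤ n →
      ((⌈(n : ℝ) ^ (ε * Real.sqrt n)⌉₊ : ℕ) : ℕ∞) ≤ μ (perPoly (Fin n) ℂ)) :
    ¬ (∀ {σ : ℕ → Type} [∀ n, Fintype (σ n)] (f : ∀ n, MvPolynomial (σ n) ℂ),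
      IsVPFamily f → (∀ n, (f n).IsHomogeneous n) →
        ∀ ε : ℝ, 0 < ε → ∃ n₀ : ℕ, ∀ n : ℕ, n₀ ≤ n →
          homProductDepthCircuitSize 2 (f n) ≤ ((⌈(n : ℝ) ^ (ε * Real.sqrt n)⌉₊ : ℕ) : ℕ∞)) := by
  intro hI
  obtain ⟨n₀, ε, hε, hlow⟩ := hwit
  obtain ⟨n₂, hup⟩ := hI g hg hghom (ε / 2) (half_pos hε)
  obtain ⟨m, hm⟩ := not_ceil_rpow_le_half hε
  set n : ℕ := max (max n₀ n₁) (max n₂ m) with hn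
  have hn₀ : n₀ ≤ n := le_max_of_le_left (le_max_left _ _)
  have hn₁ : n₁ ≤ n := le_max_of_le_left (le_max_right _ _)
  have hn₂ : n₂ ≤ n := le_max_of_le_right (le_max_left _ _)
  have hnm : m ≤ n := le_max_of_le_right (le_max_right _ _)
  have h12 : ((⌈(n : ℝ) ^ (ε * Real.sqrt n)⌉₊ : ℕ) : ℕ∞) ≤
      ((⌈(n : ℝ) ^ (ε / 2 * Real.sqrt n)⌉₊ : ℕ) : ℕ∞) :=
    (hlow n hn₀).trans ((hdom n hn₁).trans ((hμ (g n)).trans (hup n hn₂)))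
  exact hm n hnm (by exact_mod_cast h12)

end Summit.ValiantsHypothesis.ValiantsHypothesis.Theorems.Depth4ChasmAxis

end
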